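import Literature.NumberTheory.Automorphic.ShimuraCurveRibetTakahashiPeterssonTwoPowerLevelProofs
import Literature.NumberTheory.EllipticCurves.CongruenceNumber
import Literature.NumberTheory.EllipticCurves.CuspFormLFunctionFrickeProofs
import HarnessLib

/-!
# O5 (`9 ∣ N`): the quadratic twist by `(−3/·)` is a Petersson ISOMETRY on `3`-depleted cusp forms

HONEST FRAMING (cell `b2b-bsdres`, run/shared/lean/b2b/bsd-rank1-residual/, verbatim in every
file): the goal of the cell is to DELETE the COMBINATION-SHAPED residual classes of the
Birch–Swinnerton-Dyer formula for ALL analytic-rank `≤ 1` elliptic curves over `ℚ` — assembled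
STRICTLY from published theorems — so that the rank-`≤ 1` remainder becomes exactly the
CONSTRUCTION-SHAPED classes, which are TYPED, NOT attempted. This is not "finishing BSD". Lane
CLASS-CLOSURE, team o5 (`9 ∥ N`); planner o5-r2 GEN 7's ask (G7-2)/N2 'TWIN'; prover seat
`b2b-bsdres-x11b3-p5` (gen. 7, cross-cell pool). THEOREMS ONLY (no definition, no named fact, no
`sorry`); nothing booked; no RESIDUAL-MAP mark / label / count moved; O5 OPEN. A TOOL file:
unconditional kernel lemmas about the tree's twist `charTwist` (Shimura 1971, Prop. 3.64) and the
tree's Petersson product; it asserts nothing about any elliptic curve.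

Let `9 ∣ N`, `χ = (−3/·)` the primitive quadratic character mod `3`, `R f := charTwist N _ _ _ f`
(`aₙ(R f) = χ(n) aₙ(f)`); call `f` **`3`-depleted** if `aₙ(f) = 0` whenever `3 ∣ n` (every newform
of level `N` is). MAIN LEMMA (`peterssonProduct_charTwist_charTwist`): **for `3`-depleted `f` and
EVERY `x ∈ S_k(Γ₀(N))`, `⟨R f, R x⟩ = ⟨f, x⟩`.** Proof: the translations `τ ↦ τ + u/3` NORMALISE
`Γ₀(N)` (`3 ∣ 24`, `9 ∣ N`; tree `conj_translGL_gamma0_eq`, `exists_gamma0Translate`) and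
Diamond–Shurman Prop. 5.5.2(a) (`peterssonProduct_translate_adjoint`) gives
`⟨T_u f, T_v x⟩ = ⟨f, T_{v−u} x⟩`; expanding `R = g(χ)⁻¹(T_1 − T_2)`:
`⟨T_1 f − T_2 f, T_1 x − T_2 x⟩ = 2⟨f, x⟩ − ⟨f, T_1 x⟩ − ⟨f, T_{−1} x⟩ = 2⟨f, x⟩ − ⟨T_{−1} f + T_1 f, x⟩`
and `T_1 f + T_{−1} f = −f` for `3`-depleted `f` (`ζⁿ + ζ⁻ⁿ = −1`, `3 ∤ n`); total `3⟨f, x⟩`, times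
`|g(χ)|⁻² = 1/3`. Consequences: `R(R f) = f`, `R` maps `(ℤf)^⊥` to `(ℤ Rf)^⊥`, `x − R(R x) ⊥ f` —
the inputs of TWIN (`O5/CongruenceNumberTwistThree.lean`). No newform theory is used.

References: [Shimura1971] Prop. 3.64; [DiamondShurman2005] Prop. 5.5.2(a); [AgasheRibetStein2012]
§2.1; cell file `HOME/b2b-bsdres-o5-r2/gen7/TWIN-PROOF.md` (planner's sketch), TARGETS §O5.
-/

noncomputable section

open scoped MatrixGroups ModularForm ComplexConjugate Real

open Matrix.SpecialLinearGroup Matrix.GeneralLinearGroup UpperHalfPlane Complex ConjAct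
  CongruenceSubgroup Literature.NumberTheory.EllipticCurves.ModularForms
  Literature.NumberTheory.Automorphic

namespace Summit.BirchSwinnertonDyer.Rank1Residual.O5

/-! ### §1 The quadratic character mod `3` -/

section Chi

variable {χ : DirichletCharacter ℂ 3}

/-- `χ(0) = 0` for a Dirichlet character mod `3`. [folklore] -/
theorem chi_three_apply_zero (χ : DirichletCharacter ℂ 3) : χ 0 = 0 :=
  χ.map_nonunit not_isUnit_zero

/-- **`χ(2) = −1` for the primitive quadratic character mod `3`** (`χ(2)² = χ(1) = 1` excludes `0`;
`χ(2) = 1` would make `χ` trivial, of conductor `1 ≠ 3`). [folklore] -/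
theorem chi_three_apply_two (hχ : χ.IsQuadratic) (hprim : χ.IsPrimitive) : χ 2 = -1 := by
  have h22 : χ 2 * χ 2 = 1 := by
    rw [← map_mul, show (2 : ZMod 3) * 2 = 1 from by decide, map_one]
  rcases hχ 2 with h0 | h1 | hm1
  · rw [h0, mul_zero] at h22; exact absurd h22 zero_ne_one
  · exfalso
    have hone : χ = 1 := by
      refine MulChar.ext fun a ↦ ?_
      rw [MulChar.one_apply_coe]
      have key : ∀ x : ZMod 3, IsUnit x → χ x = 1 := by
        intro x hx
        fin_cases x
        · exact absurd hx not_isUnit_zero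
        · exact map_one χ
        · exact h1
      exact key _ a.isUnit
    have hc := hprim
    rw [DirichletCharacter.IsPrimitive, hone, DirichletCharacter.conductor_one] at hc
    exact absurd hc (by norm_num)
  · exact hm1

/-- The values of a quadratic character are integers. [folklore] -/
theorem exists_intCast_eq_chi_apply (hχ : χ.IsQuadratic) (a : ZMod 3) : ∃ z : ℤ, (z : ℂ) = χ a := by
  rcases hχ a with h | h | h
  · exact ⟨0, by rw [h, Int.cast_zero]⟩
  · exact ⟨1, by rw [h, Int.cast_one]⟩
  · exact ⟨-1, by rw [h, Int.cast_neg, Int.cast_one]⟩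

/-- `χ(n) = 0` for `3 ∣ n`. [folklore] -/
theorem chi_three_natCast_eq_zero (χ : DirichletCharacter ℂ 3) {n : ℕ} (hn : 3 ∣ n) :
    χ (n : ZMod 3) = 0 := by
  rw [(ZMod.natCast_eq_zero_iff n 3).mpr hn]
  exact chi_three_apply_zero χ

/-- `χ(n)² = 1` for `3 ∤ n` and `χ` quadratic. [folklore] -/
theorem chi_three_natCast_sq (hχ : χ.IsQuadratic) {n : ℕ} (hn : ¬ 3 ∣ n) :
    χ (n : ZMod 3) ^ 2 = 1 := by
  haveI : Fact (Nat.Prime 3) := ⟨Nat.prime_three⟩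
  refine apply_sq_eq_one_of_isQuadratic hχ ?_
  rw [isUnit_iff_ne_zero, ne_eq, ZMod.natCast_eq_zero_iff]
  exact hn

end Chi

/-! ### §2 The twist by `(−3/·)` at level `9 ∣ N`: `q`-expansion algebra -/

section Twist

variable {N : ℕ} [NeZero N] {k : ℤ} (h9 : 3 ^ 2 ∣ N) {χ : DirichletCharacter ℂ 3}
  (hχ : χ.IsQuadratic)

/-- The twist is additive: `R(f + g) = R f + R g` (coefficientwise). [folklore] -/
theorem charTwist_add (hprim : χ.IsPrimitive) (f g : CuspForm (Gamma0 N) k) :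
    charTwist N dvd_rfl h9 hχ (f + g) = charTwist N dvd_rfl h9 hχ f + charTwist N dvd_rfl h9 hχ g := by
  refine eq_of_forall_cuspCoeff_eq_gamma0 fun n ↦ ?_
  rw [cuspCoeff_add_form (one_mem_strictPeriods_coe_gamma0 N), cuspCoeff_charTwist N _ h9 hχ hprim,
    cuspCoeff_charTwist N _ h9 hχ hprim, cuspCoeff_charTwist N _ h9 hχ hprim,
    cuspCoeff_add_form (one_mem_strictPeriods_coe_gamma0 N), mul_add]

/-- The twist is `ℂ`-homogeneous: `R(c • f) = c • R f`. [folklore] -/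
theorem charTwist_smul (hprim : χ.IsPrimitive) (c : ℂ) (f : CuspForm (Gamma0 N) k) :
    charTwist N dvd_rfl h9 hχ (c • f) = c • charTwist N dvd_rfl h9 hχ f := by
  refine eq_of_forall_cuspCoeff_eq_gamma0 fun n ↦ ?_
  rw [cuspCoeff_smul, cuspCoeff_charTwist N _ h9 hχ hprim, cuspCoeff_charTwist N _ h9 hχ hprim,
    cuspCoeff_smul, mul_left_comm]

/-- The twist is `ℤ`-homogeneous: `R(z • f) = z • R f`. [folklore] -/
theorem charTwist_zsmul (hprim : χ.IsPrimitive) (z : ℤ) (f : CuspForm (Gamma0 N) k) :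
    charTwist N dvd_rfl h9 hχ (z • f) = z • charTwist N dvd_rfl h9 hχ f := by
  rw [← Int.cast_smul_eq_zsmul ℂ z f, charTwist_smul h9 hχ hprim, Int.cast_smul_eq_zsmul]

/-- The twist is `3`-DEPLETED: `aₙ(R f) = 0` for `3 ∣ n` (`χ(n) = 0`). [folklore] -/
theorem cuspCoeff_charTwist_eq_zero_of_dvd (hprim : χ.IsPrimitive) (f : CuspForm (Gamma0 N) k) {n : ℕ}
    (hn : 3 ∣ n) :
    cuspCoeff (charTwist N dvd_rfl h9 hχ f) n = 0 := by
  rw [cuspCoeff_charTwist N _ h9 hχ hprim, chi_three_natCast_eq_zero χ hn, zero_mul]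

/-- **The twist is an INVOLUTION on `3`-depleted forms**: `R(R f) = f` (`χ(n)² = 1`, `3 ∤ n`). [folklore] -/
theorem charTwist_charTwist (hprim : χ.IsPrimitive) {f : CuspForm (Gamma0 N) k}
    (hf : ∀ n, 3 ∣ n → cuspCoeff f n = 0) :
    charTwist N dvd_rfl h9 hχ (charTwist N dvd_rfl h9 hχ f) = f := by
  refine eq_of_forall_cuspCoeff_eq_gamma0 fun n ↦ ?_
  rw [cuspCoeff_charTwist N _ h9 hχ hprim, cuspCoeff_charTwist N _ h9 hχ hprim, ← mul_assoc, ← sq]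
  by_cases hn : 3 ∣ n
  · rw [hf n hn, mul_zero]
  · rw [chi_three_natCast_sq hχ hn, one_mul]

/-- The twist maps `S_k(Γ₀(N); ℤ)` into itself (`χ(n) ∈ {0, ±1}`). [folklore] -/
theorem charTwist_mem_integralCuspForms0 (hprim : χ.IsPrimitive) {f : CuspForm (Gamma0 N) k}
    (hf : f ∈ integralCuspForms0 N k) : charTwist N dvd_rfl h9 hχ f ∈ integralCuspForms0 N k := by
  intro n
  obtain ⟨a, ha⟩ := hf n
  obtain ⟨z, hz⟩ := exists_intCast_eq_chi_apply hχ (n : ZMod 3)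
  exact ⟨z * a, by rw [cuspCoeff_charTwist N _ h9 hχ hprim, Int.cast_mul, hz, ha]⟩

end Twist

/-! ### §3 Translates by `u/3` on `Γ₀(N)` and their Petersson products -/

section Translate

variable {N : ℕ} [NeZero N] {k : ℤ}

/-- `3 ∣ 24`. [folklore] -/
private theorem three_dvd_twentyFour : (3 : ℕ) ∣ 24 := by norm_num

/-- `[1, a; 0, 1]·[1, b; 0, 1] = [1, a + b; 0, 1]` in `GL(2, ℝ)`. [folklore] -/
theorem glCast_translGL_mul_glCast_translGL (a b : ℚ) :
    glCast (translGL a : GL (Fin 2) ℚ) * glCast (translGL b : GL (Fin 2) ℚ) =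
      glCast (translGL (a + b) : GL (Fin 2) ℚ) := by
  refine Units.ext ?_
  rw [Matrix.GeneralLinearGroup.coe_mul, coe_glCast_translGL, coe_glCast_translGL,
    coe_glCast_translGL, Matrix.mul_fin_two]
  push_cast
  ext i j
  fin_cases i <;> fin_cases j <;> simp [add_comm]

/-- `[1, 0; 0, 1] = 1`. [folklore] -/
theorem glCast_translGL_zero : glCast (translGL 0 : GL (Fin 2) ℚ) = 1 := by
  refine Units.ext ?_
  rw [coe_glCast_translGL, Rat.cast_zero]
  ext i j
  fin_cases i <;> fin_cases j <;> simp

/-- **Translates exist on `Γ₀(N)`** (`9 ∣ N`): some `X ∈ S_k(Γ₀(N))` has underlying function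
`x ∣[k] [1, u/3; 0, 1]` (`3 ∣ 24`; tree `exists_gamma0Translate`). [cite: DiamondShurman2005, Prop. 5.5.2(a)] -/
theorem exists_translate_three (h9 : 3 ^ 2 ∣ N) (x : CuspForm (Gamma0 N) k) (u : ℤ) :
    ∃ X : CuspForm (Gamma0 N) k,
      (⇑X : ℍ → ℂ) = (⇑x : ℍ → ℂ) ∣[k] glCast (translGL ((u : ℚ) / 3) : GL (Fin 2) ℚ) :=
  exists_gamma0Translate N h9 three_dvd_twentyFour x u

omit [NeZero N] in
/-- **`q`-expansion of a translate**: if `⇑X = x ∣[k] [1, u/3; 0, 1]` then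
`aₙ(X) = e^{2πi n u/3} aₙ(x)`. [folklore] -/
theorem cuspCoeff_of_coe_eq_slash_translGL {x X : CuspForm (Gamma0 N) k} {q : ℚ}
    (hX : (⇑X : ℍ → ℂ) = (⇑x : ℍ → ℂ) ∣[k] glCast (translGL q : GL (Fin 2) ℚ)) (n : ℕ) :
    cuspCoeff X n = Complex.exp (2 * π * Complex.I * q * n) * cuspCoeff x n := by
  have hΓ := one_mem_strictPeriods_coe_gamma0 N
  have hsum : ∀ τ : ℍ, HasSum (fun m : ℕ ↦ (Complex.exp (2 * π * Complex.I * q * m) * cuspCoeff x m) •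
      Function.Periodic.qParam 1 (τ : ℂ) ^ m) (X τ) := by
    intro τ
    have h := hasSum_cuspCoeff_exp x (((q : ℝ)) +ᵥ τ)
    rw [show X τ = x (((q : ℝ)) +ᵥ τ) by rw [← slash_translGL_apply (⇑x) k q τ, ← hX]]
    refine h.congr_fun fun m ↦ ?_
    have key : Complex.exp (2 * π * Complex.I * q * m) * Function.Periodic.qParam 1 (τ : ℂ) ^ m =
        Complex.exp (2 * π * Complex.I * m * ((((q : ℝ)) +ᵥ τ : ℍ) : ℂ)) := by
      rw [Function.Periodic.qParam, ← Complex.exp_nat_mul, ← Complex.exp_add, UpperHalfPlane.coe_vadd]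
      congr 1
      push_cast
      ring
    rw [smul_eq_mul, mul_right_comm, key, mul_comm]
  rw [cuspCoeff, ← ModularFormClass.qExpansion_coeff_unique one_pos hΓ hsum n]

/-- **Adjointness of translates** (DS Prop. 5.5.2(a), `α = [1, u/3; 0, 1]` normalising `Γ₀(N)`):
`⇑F = f∣[1,u/3;0,1]`, `⇑X = x∣[1,v/3;0,1]`, `⇑Y = x∣[1,w/3;0,1]`, `u + w = v` ⇒ `⟨F, X⟩ = ⟨f, Y⟩`.
[cite: DiamondShurman2005, Prop. 5.5.2(a)] -/
theorem peterssonProduct_translate_translate (h9 : 3 ^ 2 ∣ N) {f x F X Y : CuspForm (Gamma0 N) k}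
    {u v w : ℤ} (huvw : u + w = v)
    (hF : (⇑F : ℍ → ℂ) = (⇑f : ℍ → ℂ) ∣[k] glCast (translGL ((u : ℚ) / 3) : GL (Fin 2) ℚ))
    (hX : (⇑X : ℍ → ℂ) = (⇑x : ℍ → ℂ) ∣[k] glCast (translGL ((v : ℚ) / 3) : GL (Fin 2) ℚ))
    (hY : (⇑Y : ℍ → ℂ) = (⇑x : ℍ → ℂ) ∣[k] glCast (translGL ((w : ℚ) / 3) : GL (Fin 2) ℚ)) :
    peterssonProduct (Gamma0 N) k F X = peterssonProduct (Gamma0 N) k f Y := by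
  subst huvw
  have hSL : ((Gamma0 N : Subgroup SL(2, ℤ)) : Subgroup (GL (Fin 2) ℝ)) ≤ 𝒮ℒ :=
    Subgroup.map_le_range _ _
  have hYX : (⇑Y : ℍ → ℂ) = (⇑X : ℍ → ℂ) ∣[k] glCast (translGL (-((u : ℚ) / 3)) : GL (Fin 2) ℚ) := by
    rw [hY, hX, ← SlashAction.slash_mul, glCast_translGL_mul_glCast_translGL]
    congr 3
    push_cast
    ring
  have h := peterssonProduct_translate_adjoint ((Gamma0 N : Subgroup SL(2, ℤ)) : Subgroup (GL (Fin 2) ℝ))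
    hSL k (translGL ((u : ℚ) / 3)) (translGL (-((u : ℚ) / 3))) (coe_translGL_neg_eq_adjugate _)
    ((Gamma0 N : Subgroup SL(2, ℤ)) : Subgroup (GL (Fin 2) ℝ))
    (conj_translGL_gamma0_eq h9 three_dvd_twentyFour u).symm hSL f X F Y hF hYX
  rw [peterssonProduct_conj_symm_holds _ k X F, h, peterssonProduct_conj_symm_holds _ k f Y,
    Complex.conj_conj]

omit [NeZero N] in
/-- A translate by `0` is the form itself. [folklore] -/
theorem eq_of_coe_eq_slash_translGL_zero {x X : CuspForm (Gamma0 N) k} {q : ℚ}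
    (hX : (⇑X : ℍ → ℂ) = (⇑x : ℍ → ℂ) ∣[k] glCast (translGL q : GL (Fin 2) ℚ)) (hq : q = 0) :
    X = x := by
  subst hq
  apply DFunLike.ext'
  rw [hX, glCast_translGL_zero, SlashAction.slash_one]

/-- `ζⁿ + ζ⁻ⁿ = −1` for `ζ = e^{2πi/3}` and `3 ∤ n`. [folklore] -/
theorem exp_third_add_exp_neg_third {n : ℕ} (hn : ¬ 3 ∣ n) :
    Complex.exp (2 * π * Complex.I * ((((1 : ℤ) : ℚ) / 3 : ℚ) : ℂ) * n) +
      Complex.exp (2 * π * Complex.I * ((((-1 : ℤ) : ℚ) / 3 : ℚ) : ℂ) * n) = -1 := by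
  set z : ℂ := Complex.exp (2 * π * Complex.I * ((((1 : ℤ) : ℚ) / 3 : ℚ) : ℂ) * n) with hz
  have hπ : (2 * π * Complex.I : ℂ) ≠ 0 := by simp [Real.pi_ne_zero, Complex.I_ne_zero]
  have hz3 : z ^ 3 = 1 := by
    rw [hz, ← Complex.exp_nat_mul, Complex.exp_eq_one_iff]
    refine ⟨n, ?_⟩
    push_cast
    ring
  have hz1 : z ≠ 1 := by
    intro h
    rw [hz, Complex.exp_eq_one_iff] at h
    obtain ⟨m, hm⟩ := h
    push_cast at hm
    have h3 : (2 * π * Complex.I : ℂ) * n = (2 * π * Complex.I : ℂ) * (3 * m) := by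
      linear_combination 3 * hm
    have h3' : (n : ℂ) = 3 * m := mul_left_cancel₀ hπ h3
    have h3'' : (n : ℤ) = 3 * m := by exact_mod_cast h3'
    have hdvd : ((3 : ℕ) : ℤ) ∣ (n : ℤ) := ⟨m, by rw [h3'']; norm_num⟩
    exact hn (Int.natCast_dvd_natCast.mp hdvd)
  have hneg : Complex.exp (2 * π * Complex.I * ((((-1 : ℤ) : ℚ) / 3 : ℚ) : ℂ) * n) = z⁻¹ := by
    rw [hz, ← Complex.exp_neg]
    congr 1
    push_cast
    ring
  have hz0 : z ≠ 0 := Complex.exp_ne_zero _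
  have hinv : z⁻¹ = z ^ 2 := by
    rw [inv_eq_iff_eq_inv, eq_comm, inv_eq_of_mul_eq_one_right]
    linear_combination hz3
  rw [hneg, hinv]
  have hfac : (z - 1) * (z + z ^ 2 + 1) = 0 := by linear_combination hz3
  rcases mul_eq_zero.mp hfac with h | h
  · exact absurd (sub_eq_zero.mp h) hz1
  · linear_combination h

end Translate

/-! ### §4 The isometry and its consequences -/

section Isometry

variable {N : ℕ} [NeZero N] {k : ℤ} (h9 : 3 ^ 2 ∣ N) {χ : DirichletCharacter ℂ 3}
  (hχ : χ.IsQuadratic)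

omit [NeZero N] in
/-- **`T_{1/3} f + T_{−1/3} f = −f` for `3`-depleted `f`** (`(ζⁿ + ζ⁻ⁿ) aₙ = −aₙ` for `3 ∤ n`). [folklore] -/
theorem translate_add_translate_eq_neg {f F₁ F₂ : CuspForm (Gamma0 N) k}
    (hF₁ : (⇑F₁ : ℍ → ℂ) = (⇑f : ℍ → ℂ) ∣[k] glCast (translGL (((1 : ℤ) : ℚ) / 3) : GL (Fin 2) ℚ))
    (hF₂ : (⇑F₂ : ℍ → ℂ) = (⇑f : ℍ → ℂ) ∣[k] glCast (translGL (((-1 : ℤ) : ℚ) / 3) : GL (Fin 2) ℚ))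
    (hf : ∀ n, 3 ∣ n → cuspCoeff f n = 0) : F₁ + F₂ = -f := by
  refine eq_of_forall_cuspCoeff_eq_gamma0 fun n ↦ ?_
  rw [cuspCoeff_add_form (one_mem_strictPeriods_coe_gamma0 N),
    cuspCoeff_neg_form (one_mem_strictPeriods_coe_gamma0 N), cuspCoeff_of_coe_eq_slash_translGL hF₁,
    cuspCoeff_of_coe_eq_slash_translGL hF₂, ← add_mul]
  by_cases hn : 3 ∣ n
  · rw [hf n hn, mul_zero, neg_zero]
  · rw [exp_third_add_exp_neg_third hn, neg_one_mul]

/-- **THE ISOMETRY: `⟨f ⊗ χ, x ⊗ χ⟩ = ⟨f, x⟩` for every `3`-DEPLETED `f ∈ S_k(Γ₀(N))` and EVERY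
`x ∈ S_k(Γ₀(N))`** (`9 ∣ N`, `χ = (−3/·)`): `f ⊗ χ = g⁻¹(F₁ − F₂)`, `x ⊗ χ = g⁻¹(X₁ − X₂)`
(`Fᵤ = f(· + u/3)`), `⟨F₁ − F₂, X₁ − X₂⟩ = 2⟨f, x⟩ − ⟨f, X₁⟩ − ⟨f, X₋₁⟩` by adjointness of
translates, `⟨f, X₁⟩ + ⟨f, X₋₁⟩ = ⟨F₋₁ + F₁, x⟩ = −⟨f, x⟩`, and `|g|² = 3`.
[cite: Shimura1971, Prop. 3.64] [cite: DiamondShurman2005, Prop. 5.5.2(a)] -/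
theorem peterssonProduct_charTwist_charTwist (hprim : χ.IsPrimitive) {f : CuspForm (Gamma0 N) k}
    (hf : ∀ n, 3 ∣ n → cuspCoeff f n = 0) (x : CuspForm (Gamma0 N) k) :
    peterssonProduct (Gamma0 N) k (charTwist N dvd_rfl h9 hχ f) (charTwist N dvd_rfl h9 hχ x) =
      peterssonProduct (Gamma0 N) k f x := by
  choose F hF using fun u : ℤ ↦ exists_translate_three (k := k) h9 f u
  choose X hX using fun u : ℤ ↦ exists_translate_three (k := k) h9 x u
  set c : ℂ := (gaussSum χ⁻¹ (ZMod.stdAddChar (N := 3)))⁻¹ with hc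
  have huniv : (Finset.univ : Finset (ZMod 3)) = {0, 1, 2} := by decide
  have hv1 : (((1 : ZMod 3).val : ℤ)) = 1 := by decide
  have hv2 : (((2 : ZMod 3).val : ℤ)) = 2 := by decide
  have hR : ∀ (y : CuspForm (Gamma0 N) k) (Y : ℤ → CuspForm (Gamma0 N) k),
      (∀ u : ℤ, (⇑(Y u) : ℍ → ℂ) = (⇑y : ℍ → ℂ) ∣[k] glCast (translGL ((u : ℚ) / 3) : GL (Fin 2) ℚ)) →
      charTwist N dvd_rfl h9 hχ y = c • (Y 1 - Y 2) := by
    intro y Y hY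
    have hsum : charTwist N dvd_rfl h9 hχ y = c • ∑ u : ZMod 3, χ⁻¹ u • Y (u.val : ℤ) := by
      apply DFunLike.ext'
      rw [coe_charTwist, coe_twistRaw, CuspForm.IsGLPos.coe_smul]
      congr 1
      have h := map_sum (CuspForm.coeHom (Γ := ((Gamma0 N : Subgroup SL(2, ℤ)) :
        Subgroup (GL (Fin 2) ℝ))) (k := k)) (fun u : ZMod 3 ↦ χ⁻¹ u • Y (u.val : ℤ)) Finset.univ
      refine (Finset.sum_congr rfl fun u _ ↦ ?_).trans h.symm
      change χ⁻¹ u • ((⇑y : ℍ → ℂ) ∣[k] twistT u) = ⇑(χ⁻¹ u • Y (u.val : ℤ))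
      rw [CuspForm.IsGLPos.coe_smul, hY, ← glCast_translGL_eq_twistT u, Nat.cast_ofNat]
    rw [hsum, huniv, Finset.sum_insert (by decide), Finset.sum_insert (by decide), Finset.sum_singleton,
      hχ.inv, chi_three_apply_zero, map_one, chi_three_apply_two hχ hprim, zero_smul, zero_add, one_smul,
      neg_one_smul, hv1, hv2, sub_eq_add_neg]
  have hRf := hR f F hF
  have hRx := hR x X hX
  have e11 : peterssonProduct (Gamma0 N) k (F 1) (X 1) = peterssonProduct (Gamma0 N) k f x := by
    rw [peterssonProduct_translate_translate h9 (w := 0) (by norm_num) (hF 1) (hX 1) (hX 0),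
      eq_of_coe_eq_slash_translGL_zero (hX 0) (by simp)]
  have e22 : peterssonProduct (Gamma0 N) k (F 2) (X 2) = peterssonProduct (Gamma0 N) k f x := by
    rw [peterssonProduct_translate_translate h9 (w := 0) (by norm_num) (hF 2) (hX 2) (hX 0),
      eq_of_coe_eq_slash_translGL_zero (hX 0) (by simp)]
  have e12 : peterssonProduct (Gamma0 N) k (F 1) (X 2) = peterssonProduct (Gamma0 N) k f (X 1) :=
    peterssonProduct_translate_translate h9 (w := 1) (by norm_num) (hF 1) (hX 2) (hX 1)
  have e21 : peterssonProduct (Gamma0 N) k (F 2) (X 1) = peterssonProduct (Gamma0 N) k f (X (-1)) :=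
    peterssonProduct_translate_translate h9 (w := -1) (by norm_num) (hF 2) (hX 1) (hX (-1))
  have e1 : peterssonProduct (Gamma0 N) k (F (-1)) x = peterssonProduct (Gamma0 N) k f (X 1) := by
    have h := peterssonProduct_translate_translate h9 (u := -1) (v := 0) (w := 1) (by norm_num)
      (hF (-1)) (hX 0) (hX 1)
    rwa [eq_of_coe_eq_slash_translGL_zero (hX 0) (by simp)] at h
  have e2 : peterssonProduct (Gamma0 N) k (F 1) x = peterssonProduct (Gamma0 N) k f (X (-1)) := by
    have h := peterssonProduct_translate_translate h9 (u := 1) (v := 0) (w := -1) (by norm_num)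
      (hF 1) (hX 0) (hX (-1))
    rwa [eq_of_coe_eq_slash_translGL_zero (hX 0) (by simp)] at h
  have esum : peterssonProduct (Gamma0 N) k f (X 1) + peterssonProduct (Gamma0 N) k f (X (-1)) =
      -peterssonProduct (Gamma0 N) k f x := by
    rw [← e1, ← e2, add_comm, ← peterssonProduct_add_left, translate_add_translate_eq_neg (hF 1) (hF (-1)) hf,
      ← neg_one_smul ℂ f, peterssonProduct_smul_left, map_neg, map_one, neg_one_mul]
  have hg3 : ‖gaussSum χ⁻¹ (ZMod.stdAddChar (N := 3))‖ ^ 2 = (3 : ℝ) := by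
    exact_mod_cast Literature.NumberTheory.Sieve.LargeSieve.norm_gaussSum_sq (isPrimitive_inv hprim)
  have hcc : conj c * c = (3 : ℂ)⁻¹ := by
    rw [← Complex.normSq_eq_conj_mul_self, hc, map_inv₀, Complex.normSq_eq_norm_sq, hg3]
    norm_num
  have expand : peterssonProduct (Gamma0 N) k (F 1 - F 2) (X 1 - X 2) =
      peterssonProduct (Gamma0 N) k (F 1) (X 1) - peterssonProduct (Gamma0 N) k (F 1) (X 2) -
        peterssonProduct (Gamma0 N) k (F 2) (X 1) + peterssonProduct (Gamma0 N) k (F 2) (X 2) := by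
    rw [sub_eq_add_neg, sub_eq_add_neg, ← neg_one_smul ℂ (F 2), ← neg_one_smul ℂ (X 2),
      peterssonProduct_add_left, peterssonProduct_add_right, peterssonProduct_add_right,
      peterssonProduct_smul_left, peterssonProduct_smul_right, peterssonProduct_smul_right,
      peterssonProduct_smul_left, map_neg, map_one]
    ring
  rw [hRf, hRx, peterssonProduct_smul_smul, expand, e11, e12, e21, e22, hcc]
  linear_combination (-(3 : ℂ)⁻¹) * esum

/-- **Orthogonality transport**: `⟨f, x⟩ = 0 ⇒ ⟨f ⊗ χ, x ⊗ χ⟩ = 0` (`3`-depleted `f`). [cite: Shimura1971, Prop. 3.64] -/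
theorem peterssonProduct_charTwist_charTwist_eq_zero (hprim : χ.IsPrimitive)
    {f : CuspForm (Gamma0 N) k} (hf : ∀ n, 3 ∣ n → cuspCoeff f n = 0) {x : CuspForm (Gamma0 N) k}
    (hx : peterssonProduct (Gamma0 N) k f x = 0) :
    peterssonProduct (Gamma0 N) k (charTwist N dvd_rfl h9 hχ f) (charTwist N dvd_rfl h9 hχ x) = 0 := by
  rw [peterssonProduct_charTwist_charTwist h9 hχ hprim hf, hx]

/-- **`x − (x ⊗ χ) ⊗ χ ⊥ f`** for `3`-depleted `f`, any `x`: `⟨f, RRx⟩ = ⟨RRf, RRx⟩ = ⟨Rf, Rx⟩ = ⟨f, x⟩`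
(isometry twice, `RRf = f`). [cite: Shimura1971, Prop. 3.64] -/
theorem peterssonProduct_sub_charTwist_charTwist_eq_zero (hprim : χ.IsPrimitive)
    {f : CuspForm (Gamma0 N) k} (hf : ∀ n, 3 ∣ n → cuspCoeff f n = 0) (x : CuspForm (Gamma0 N) k) :
    peterssonProduct (Gamma0 N) k f
      (x - charTwist N dvd_rfl h9 hχ (charTwist N dvd_rfl h9 hχ x)) = 0 := by
  have h2 := peterssonProduct_charTwist_charTwist h9 hχ hprim
    (f := charTwist N dvd_rfl h9 hχ f) (fun n hn ↦ cuspCoeff_charTwist_eq_zero_of_dvd h9 hχ hprim f hn)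
    (charTwist N dvd_rfl h9 hχ x)
  rw [charTwist_charTwist h9 hχ hprim hf, peterssonProduct_charTwist_charTwist h9 hχ hprim hf] at h2
  rw [sub_eq_add_neg, peterssonProduct_add_right, ← neg_one_smul ℂ (charTwist N dvd_rfl h9 hχ _),
    peterssonProduct_smul_right, h2, neg_one_mul, add_neg_cancel]

end Isometry

end Summit.BirchSwinnertonDyer.Rank1Residual.O5
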